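import Literature.MathematicalPhysics.QuantumFieldTheory.Balaban1983to89.B9Eq3126H1RowLettersDiagonalClosed
import Literature.MathematicalPhysics.QuantumFieldTheory.Balaban1983to89.B9Eq349ConjugatedQGGQInvBlockDecayTower
import Literature.MathematicalPhysics.QuantumFieldTheory.Balaban1983to89.B9Eq347LocalFromBlockDecay
import Literature.MathematicalPhysics.QuantumFieldTheory.Balaban1983to89.B9Eq326LocalPartGradientRowAdjoint
import Literature.MathematicalPhysics.QuantumFieldTheory.Balaban1983to89.B9Eq325ProjFormulaTower

/-!
# `Balaban1983to89.B9Eq326WoodburyLettersTower` — T. Bałaban, *Propagators for lattice gauge theories in a background field*, Commun. Math. Phys. **99** (1985)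
# 389–434 [Balaban1985BackgroundPropagators] (3.25)–(3.26) pp. 394–395, Thm 3.11 p. 416, (3.49) p. 399, p. 391 *«The adjoints are taken with respect to natural
# L² scalar products»*: **TWO OF THE TOWER INPUTS OF THE WOODBURY SUP ROW OF `G₁,k`, CLOSED FROM THE TREE — (i) the adjoint facts `Uu† = V`
# (`Uu = D_UG′_kQ̃′_k†`, `V = Q̃′_kG′_kD*_U`) and `A₀,k⁻¹† = A₀,k⁻¹` at a unitary background, as linear AND as continuous linear maps; (ii) the (L) sup letter
# of the inverse third operator `c_k = (Q̃′_kG′_k²Q̃′_k†)⁻¹` on the unit lattice with `∃ (α₁, C, ρ)` BEFORE the height** — the `hVadj`, `hAadj` and `hC`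
# slots of this lineage's abstract assembly `B9Eq326G1SupRowAdjoint.local_letter_G1_torus` (beta-an4's INTERFACE REQUEST D4 `exists_local_letter_G1k`,
# journal `HOME/CLAIMS.log` l.64394; END typist = this lineage, t4-ne9-p1 g95 A-1 l.65067), every parent IN THE TREE

statement-level skeleton of published theorems with citation tags; proofs where landed; nothing here is a claim about the Yang–Mills mass gap

CITATION HEADER (lean-in-tree rule).  Audit cell `pub-balaban`, sub-cell `t4`, BINDER row NE9; filed by NE9 crux-team LEAF PROVER 05
(`b2b-balaban-t4-ne9-formalise-leaf-05`, gen 87).  Composed BY NAME, nothing restated: this lineage's `B9Eq326LocalPartGradientRowAdjoint.adjoint_greenK_of_isSymmetric`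
∕ `localPart_isSymmetric` (generic in the lattice and in `Q` — here `Q := QkW`); `B9Eq324DeltaPrimeATower.laplacePrimeAk_isSymmetric`; `B11Eq103H1Complex.adjoint_covDerivL2K`;
`B9Eq310HessianHermitian.adTransportW_adjoint` ∕ `hessOp_isSymmetric_of_trace` (unitarity ⟹ `hRS`, `hessOp` symmetric); Mathlib's
`LinearMap.adjoint_toContinuousLinearMap`; ne9-leaf-03's `B9Eq3126H1RowLettersDiagonalClosed.exists_H1_row_letters_diagonal_closed` (the floor `κ₁` of
`Q̃′_kG′_k²Q̃′_k†` and its per-height letter, closed on the diagonal); t4-ne9-p1's `B9Eq349ConjugatedQGGQInvBlockDecayTower.exists_point_decay_QGGQInvk` (the point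
decay of `c_k`, `∃`-first given `κ₁`); `B9Eq325ProjFormulaTower.QGGQk_pos` (the construction of `c_k`); ne9-leaf-03's `B9Eq347LocalFromBlockDecay.local_of_point_decay_sites`.
Sources READ first-hand this generation (`paper:balaban1985-cmp99-background-propagators`, journal page = PDF page + 388): p. 394 (3.25), p. 395 (3.26), p. 397
(3.42), p. 399 (3.49) + Thm 3.3.  NOTHING of print's proof is reproduced; no constant of print is valued.

WHAT IS PROVED (sorry-free; proof lane — no `def`; [folklore] compositions).
* §1 (tower `towerP L m (n+1)`, weights `c₀`, `c₁`, `hRS`, `hpos′`) **`adjoint_GpOfUk`** (`G′_k† = G′_k`); **`adjoint_Uu_eq_V`** (`Uu† = V` for the letters `hUu`, `hV` of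
  `B9Eq326WoodburySchurTower.G1k_eq_woodbury` VERBATIM); **`adjoint_toContinuousLinearMap_Uu`** (the same for `LinearMap.toContinuousLinearMap`);
  **`adjoint_localInvK`** (`(greenK A₀ hpos₀)† = greenK A₀ hpos₀` for `A₀ = hessOp + D_U∘D*_U + Q_k†∘(a•Q_k)`, `Q_k = QkW`, at a unitary background with the tracial
  norming — both as `LinearMap` and as `ContinuousLinearMap`).
* §2 **`exists_local_letter_QGGQInvk_closed`** — `∃ α₁ C ρ > 0` BEFORE `∀ n η c₀ c₁ m U`: for every background of the MODEL letters in the window `α ≤ α₁` (the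
  (ECL)∕(FCLG) binder convention of ne9-leaf-03: `αU hα1 hU1 hreg εU hεU hUε hLb α hα hαle hUst hUb hUη hpl hεg`, plus `hρ`, `hm`), every positivity witness `hpos′`,
  every point family `r`, every `g` supported at the unit site `v` with `‖g(y)‖ ≤ F`: `‖(c_kg)(x)‖ ≤ C·e^{−ρ·d_m(x,v)}·F`, `c_k := greenK … (QGGQk_pos … hpos′)` with
  `hRS := adTransportW_adjoint φ τ hτ₂ hUst hφτ` — the operator `c` of `G1k_eq_woodbury` at a unitary background.
HONEST SCOPE.  Compositions; `α₁ := min` of the two suppliers' thresholds; `C`, `ρ` are `exists_point_decay_QGGQInvk`'s; nothing of [B9] Thm 3.1 ∕ 3.3 ∕ 3.11 is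
asserted, valued or discharged beyond what the named files prove on the cell's MODEL; «NE9 ⇐ the named binders»; NE9 NOT PRINTED ∕ NOT PROVED; row WALLED ON
A MODEL (O-NE9-1; #5 UNRULED); spine PROVED 0∕9; rung (B)+1 on a finite T⁴ — NOT infinite volume, NOT mass gap, NOT BetaPertH, NOT Clay.  HONEST DEPENDENCY:
continuum YM on T⁴ ⇐ BetaPertH ∧ nine spine estimates (0/9 proved); BetaPertH ⇐ (D1) ∧ (D4) ∧ CAP+tail; G-an2-4 gates asym, D1 and NE2/3/4.  NEW file whose every
parent is BUILT; nothing modified.  Net new unproved facts: 0.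
-/

noncomputable section

set_option autoImplicit false

open scoped InnerProductSpace ComplexConjugate BigOperators

namespace Literature.MathematicalPhysics.QuantumFieldTheory.Balaban1983to89.B9Eq326WoodburyLettersTower

open B4Sect5Torus (TSite tdist)
open B9SectCLatticeCarrier (Bond DirPair)
open B9Eq311L2Pairing (WL2)
open B11Eq103H1Complex (SiteL2K BondL2K covDerivL2K covDivL2K greenK apply_greenK adjoint_covDerivL2K)
open B9Eq310HessianOperator (adTransportW hessOp)
open B9Eq310HessianHermitian (adTransportW_adjoint hessOp_isSymmetric_of_trace)
open B9Eq310DeltaPrime (plaqHolU)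
open B9Eq315QTower (towerP UlevOf)
open B9Eq315QTorus (perCfg cornerSite)
open B7Prop1Explicit (U1 Wcx boxVec)
open B9Eq326OperatorTower (QkW QprimeTowerW)
open B9Eq324DeltaPrimeATower (laplacePrimeAk GpOfUk laplacePrimeAk_isSymmetric)
open B9Eq325ProjFormulaTower (QGGQk_pos)
open B9Eq326LocalPartGradientRowAdjoint (adjoint_greenK_of_isSymmetric localPart_isSymmetric)
open B9Eq3126H1RowLettersDiagonalClosed (exists_H1_row_letters_diagonal_closed)
open B9Eq349ConjugatedQGGQInvBlockDecayTower (exists_point_decay_QGGQInvk)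
open B9Eq347LocalFromBlockDecay (local_of_point_decay_sites)

/-! ## §1 The adjoint facts of the Woodbury letters at the tower: `Uu† = V`, `A₀,k⁻¹† = A₀,k⁻¹` -/

section Adjoint

variable {d : ℕ} (L : ℕ) [NeZero L] (m : Fin d → ℕ) [∀ i, NeZero (m i)] (n : ℕ)
  {𝔸 : Type*} [NormedRing 𝔸] [StarRing 𝔸] [NormedAlgebra ℂ 𝔸] [StarModule ℂ 𝔸] [CompleteSpace 𝔸] [NormOneClass 𝔸]
  {W : Type*} [NormedAddCommGroup W] [InnerProductSpace ℂ W] [FiniteDimensional ℂ W] (φ : W ≃ₗ[ℂ] 𝔸) (c₀ : ℝ) [Fact (0 < c₀)]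
  (η : ℝ) (U : Bond d (towerP L m (n + 1)) → 𝔸ˣ) (c₁ : ℝ) [Fact (0 < c₁)] (a' : ℝ) (τ : 𝔸 →ₗ[ℂ] ℂ)
  (hRS : ∀ (b : Bond d (towerP L m (n + 1))) (v u : W), ⟪adTransportW φ U b v, u⟫_ℂ = ⟪v, adTransportW φ (fun b => (U b)⁻¹) b u⟫_ℂ)
  (hpos' : ∀ x : SiteL2K ℂ d (towerP L m (n + 1)) c₀ W, x ≠ 0 → 0 < RCLike.re ⟪x, laplacePrimeAk L m n φ η U a' (c₁ := c₁) x⟫_ℂ)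

omit [NormOneClass 𝔸] [StarRing 𝔸] [StarModule ℂ 𝔸] in
include hRS in
/-- **`G′_k(U)† = G′_k(U)`** (`(Δ′_{a′,k})⁻¹` of a symmetric operator: `B9Eq324DeltaPrimeATower.laplacePrimeAk_isSymmetric` through this lineage's
`B9Eq326LocalPartGradientRowAdjoint.adjoint_greenK_of_isSymmetric`). [folklore] [cite: Balaban1985BackgroundPropagators, (3.24)–(3.25) p.394, p.391] -/
theorem adjoint_GpOfUk : LinearMap.adjoint (GpOfUk L m n φ η U a' (c₁ := c₁) hpos') = GpOfUk L m n φ η U a' (c₁ := c₁) hpos' :=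
  adjoint_greenK_of_isSymmetric _ (laplacePrimeAk_isSymmetric L m n φ η U a' (c₀ := c₀) (c₁ := c₁) hRS) hpos'

omit [NormOneClass 𝔸] [StarRing 𝔸] [StarModule ℂ 𝔸] in
include hRS in
/-- **`Uu† = V` FOR THE WOODBURY LETTERS** `Uu = D_U∘G′_k∘Q̃′_k†`, `V = Q̃′_k∘G′_k∘D*_U` of `B9Eq326WoodburySchurTower.G1k_eq_woodbury` (`(D_U)† = D*_U` by
`B11Eq103H1Complex.adjoint_covDerivL2K` and `hRS`, `G′_k† = G′_k`, `Q̃′_k†† = Q̃′_k`). [folklore] [cite: Balaban1985BackgroundPropagators, (3.25)–(3.26) pp.394–395, (3.8) p.392, p.391] -/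
theorem adjoint_Uu_eq_V (Uu : SiteL2K ℂ d m c₁ W →ₗ[ℂ] BondL2K ℂ d (towerP L m (n + 1)) c₀ W)
    (hUu : Uu = covDerivL2K ℂ c₀ ((η : ℂ))⁻¹ (adTransportW φ U) ∘ₗ GpOfUk L m n φ η U a' (c₁ := c₁) hpos' ∘ₗ
      LinearMap.adjoint ((WL2.linearEquiv ℂ ℂ (fun _ : TSite d m => c₁)).symm.toLinearMap ∘ₗ QprimeTowerW L m n φ U (c₀ := c₀)))
    (V : BondL2K ℂ d (towerP L m (n + 1)) c₀ W →ₗ[ℂ] SiteL2K ℂ d m c₁ W)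
    (hV : V = ((WL2.linearEquiv ℂ ℂ (fun _ : TSite d m => c₁)).symm.toLinearMap ∘ₗ QprimeTowerW L m n φ U (c₀ := c₀)) ∘ₗ
      GpOfUk L m n φ η U a' (c₁ := c₁) hpos' ∘ₗ covDivL2K ℂ c₀ ((η : ℂ))⁻¹ (adTransportW φ fun b => (U b)⁻¹)) :
    LinearMap.adjoint Uu = V := by
  subst hUu hV
  have hD : LinearMap.adjoint (covDerivL2K ℂ c₀ ((η : ℂ))⁻¹ (adTransportW φ U)) = covDivL2K ℂ c₀ ((η : ℂ))⁻¹ (adTransportW φ fun b => (U b)⁻¹) :=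
    adjoint_covDerivL2K ((η : ℂ))⁻¹ (by rw [map_inv₀, Complex.conj_ofReal]) _ _ hRS
  rw [LinearMap.adjoint_comp, LinearMap.adjoint_comp, LinearMap.adjoint_adjoint, adjoint_GpOfUk L m n φ c₀ η U c₁ a' hRS hpos', hD,
    LinearMap.comp_assoc]

omit [NormOneClass 𝔸] [StarRing 𝔸] [StarModule ℂ 𝔸] in
include hRS in
/-- The same as an equation of CONTINUOUS linear maps (the shape of `B9Eq326G1SupRowAdjoint.local_letter_G1_torus`'s `hVadj`). [folklore]
[cite: Balaban1985BackgroundPropagators, (3.25)–(3.26) pp.394–395, p.391] -/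
theorem adjoint_toContinuousLinearMap_Uu (Uu : SiteL2K ℂ d m c₁ W →ₗ[ℂ] BondL2K ℂ d (towerP L m (n + 1)) c₀ W)
    (hUu : Uu = covDerivL2K ℂ c₀ ((η : ℂ))⁻¹ (adTransportW φ U) ∘ₗ GpOfUk L m n φ η U a' (c₁ := c₁) hpos' ∘ₗ
      LinearMap.adjoint ((WL2.linearEquiv ℂ ℂ (fun _ : TSite d m => c₁)).symm.toLinearMap ∘ₗ QprimeTowerW L m n φ U (c₀ := c₀)))
    (V : BondL2K ℂ d (towerP L m (n + 1)) c₀ W →ₗ[ℂ] SiteL2K ℂ d m c₁ W)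
    (hV : V = ((WL2.linearEquiv ℂ ℂ (fun _ : TSite d m => c₁)).symm.toLinearMap ∘ₗ QprimeTowerW L m n φ U (c₀ := c₀)) ∘ₗ
      GpOfUk L m n φ η U a' (c₁ := c₁) hpos' ∘ₗ covDivL2K ℂ c₀ ((η : ℂ))⁻¹ (adTransportW φ fun b => (U b)⁻¹)) :
    ContinuousLinearMap.adjoint (LinearMap.toContinuousLinearMap Uu) = LinearMap.toContinuousLinearMap V := by
  rw [← LinearMap.adjoint_toContinuousLinearMap, adjoint_Uu_eq_V L m n φ c₀ η U c₁ a' hRS hpos' Uu hUu V hV]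

variable (hL : 1 ≤ L) (α : ℕ → ℝ) (hα1 : ∀ j, α j ≤ 1 / 64)
  (hU1 : ∀ (j : ℕ) (x : B7Prop1Explicit.Site d) (k : Fin d), perCfg (towerP L m (j + 1)) (UlevOf L m (n + 1) U j) x k ∈ U1 𝔸)
  (hreg : ∀ (j : ℕ) (y : TSite d (towerP L m j)) (k : Fin d) (ρ' : Fin d → Fin L),
    ‖((Wcx L (perCfg (towerP L m (j + 1)) (UlevOf L m (n + 1) U j)) (cornerSite L y) k (boxVec L ρ') : 𝔸ˣ) : 𝔸) - 1‖ ≤ α j)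
  (a : ℝ) (hUst : ∀ b, star (U b : 𝔸) = (((U b)⁻¹ : 𝔸ˣ) : 𝔸)) (hτ₁ : ∀ X : 𝔸, τ (star X) = conj (τ X)) (hτ₂ : ∀ X Y : 𝔸, τ (X * Y) = τ (Y * X))
  (hφτ : ∀ X Y : 𝔸, ⟪φ.symm X, φ.symm Y⟫_ℂ = τ (star X * Y))

include hUst hτ₁ hτ₂ hφτ in
/-- **`(A₀,k⁻¹)† = A₀,k⁻¹`** for the tower local part `A₀ = Δ(U) + D_UD*_U + Q_k†(a•Q_k)` at a unitary background with a tracial norming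
(`localPart_isSymmetric` with `hessOp_isSymmetric_of_trace`, then `adjoint_greenK_of_isSymmetric`) — as linear maps and as continuous linear maps (the
`hAadj` slot of `B9Eq326G1SupRowAdjoint.local_letter_G1_torus`). [folklore] [cite: Balaban1985BackgroundPropagators, (3.26) p.395, (3.10) p.392, p.391] -/
theorem adjoint_localInvK
    (A₀ : BondL2K ℂ d (towerP L m (n + 1)) c₀ W →ₗ[ℂ] BondL2K ℂ d (towerP L m (n + 1)) c₀ W)
    (hA₀ : A₀ = hessOp φ η U τ + covDerivL2K ℂ c₀ ((η : ℂ))⁻¹ (adTransportW φ U) ∘ₗ covDivL2K ℂ c₀ ((η : ℂ))⁻¹ (adTransportW φ fun b => (U b)⁻¹) +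
      LinearMap.adjoint (QkW L m n φ U hL α hα1 hU1 hreg (c₀ := c₀) (c₁ := c₁)) ∘ₗ ((a : ℂ) • QkW L m n φ U hL α hα1 hU1 hreg (c₀ := c₀) (c₁ := c₁)))
    (hpos₀ : ∀ x : BondL2K ℂ d (towerP L m (n + 1)) c₀ W, x ≠ 0 → 0 < RCLike.re ⟪x, A₀ x⟫_ℂ) :
    LinearMap.adjoint (greenK A₀ hpos₀) = greenK A₀ hpos₀ ∧
      ContinuousLinearMap.adjoint (LinearMap.toContinuousLinearMap (greenK A₀ hpos₀)) = LinearMap.toContinuousLinearMap (greenK A₀ hpos₀) := by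
  have hRS' : ∀ (b : Bond d (towerP L m (n + 1))) (v u : W), ⟪adTransportW φ U b v, u⟫_ℂ = ⟪v, adTransportW φ (fun b => (U b)⁻¹) b u⟫_ℂ :=
    adTransportW_adjoint φ τ hτ₂ hUst hφτ
  have hsym := localPart_isSymmetric φ τ η U hRS' (hessOp_isSymmetric_of_trace φ τ hτ₁ hτ₂ η hUst hφτ) _ a A₀ hA₀
  have h := adjoint_greenK_of_isSymmetric A₀ hsym hpos₀
  exact ⟨h, by rw [← LinearMap.adjoint_toContinuousLinearMap, h]⟩

end Adjoint

/-! ## §2 The letter (L) of `c_k = (Q̃′_kG′_k²Q̃′_k†)⁻¹` on the unit lattice, CLOSED: `∃ α₁ C ρ` BEFORE the height -/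

section Core

variable {d : ℕ} (hd : 1 ≤ d) (L : ℕ) [NeZero L] (hL : 1 ≤ L) (hL3 : 3 ≤ L)
  {𝔸 : Type*} [NormedRing 𝔸] [NormedAlgebra ℂ 𝔸] [CompleteSpace 𝔸] [NormOneClass 𝔸] [StarRing 𝔸] [NormedStarGroup 𝔸] [StarModule ℂ 𝔸]
  {W : Type*} [NormedAddCommGroup W] [InnerProductSpace ℂ W] [FiniteDimensional ℂ W] (φ : W ≃ₗ[ℂ] 𝔸)
  {Mφ Mφ' : ℝ} (hMφ : 0 ≤ Mφ) (hMφ' : 0 ≤ Mφ') (hφ : ∀ w, ‖φ w‖ ≤ Mφ * ‖w‖) (hφ' : ∀ X, ‖φ.symm X‖ ≤ Mφ' * ‖X‖)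
  {a : ℝ} (ha : 0 < a) {a' : ℝ} (ha' : 0 < a') {ϱ : ℝ} (hϱ0 : 0 ≤ ϱ) (hϱ1 : ϱ < 1)
  (τ : 𝔸 →ₗ[ℂ] ℂ) {Cτ : ℝ} (hτ : ∀ X, ‖τ X‖ ≤ Cτ * ‖X‖) (hCτ : 0 ≤ Cτ) {ρw : ℝ} (hρw : 0 ≤ ρw)
  (hτ₁ : ∀ X : 𝔸, τ (star X) = conj (τ X)) (hτ₂ : ∀ X Y : 𝔸, τ (X * Y) = τ (Y * X))
  (hφτ : ∀ X Y : 𝔸, ⟪φ.symm X, φ.symm Y⟫_ℂ = τ (star X * Y)) {Mτ : ℝ} (hMτ : 0 ≤ Mτ)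

include hd hL hL3 hMφ hMφ' hφ hφ' ha ha' hϱ0 hϱ1 hτ hCτ hρw hτ₁ hτ₂ hφτ hMτ in
/-- **THE LETTER (L) OF THE INVERSE THIRD OPERATOR `c_k = (Q̃′_kG′_k(U)²Q̃′_k(U)†)⁻¹` ON THE UNIT LATTICE, CLOSED ON THE DIAGONAL — `∃ α₁ C ρ` BEFORE
`∀ n η c₀ c₁ m U`**: for every height, spacing, weights on the diagonal, period, background of the MODEL letters in the window `α ≤ α₁`, every positivity
witness `hpos′` of `Δ′_{a′,k}(U)`, every point family `r`, every source `g` supported at the unit site `v` with `‖g(y)‖ ≤ F`: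
`‖(c_kg)(x)‖ ≤ C·e^{−ρ·d_m(x,v)}·F`, `c_k := greenK … (QGGQk_pos … hpos′)` (the operator of `B9Eq326WoodburySchurTower.G1k_eq_woodbury`).  Composition BY
NAME: the floor `κ₁` and its per-height letter from ne9-leaf-03's `B9Eq3126H1RowLettersDiagonalClosed.exists_H1_row_letters_diagonal_closed`; the point decay
from t4-ne9-p1's `B9Eq349ConjugatedQGGQInvBlockDecayTower.exists_point_decay_QGGQInvk`; the letter by `B9Eq347LocalFromBlockDecay.local_of_point_decay_sites`
(blocks = points, no price) — the `hC` slot of `B9Eq326G1SupRowAdjoint.local_letter_G1_torus`. [cite: Balaban1985BackgroundPropagators, Thm 3.11 p.416,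
(3.25) p.394, (3.49) p.399, Thm 3.1 (3.42) p.397] -/
theorem exists_local_letter_QGGQInvk_closed :
    ∃ α₁ C ρ : ℝ, 0 < α₁ ∧ 0 ≤ C ∧ 0 < ρ ∧
      ∀ (n : ℕ) (η : ℝ) (_hηL : η * (L : ℝ) ^ (n + 1) = 1) (c₀ c₁ : ℝ) [Fact (0 < c₀)] [Fact (0 < c₁)]
        (_hw : c₀ * ((L : ℝ) ^ (n + 1)) ^ d = c₁) (_hρ : |η| ^ d / c₀ ≤ ρw) (m : Fin d → ℕ) [∀ i, NeZero (m i)] (_hm : ∀ i, 1 ≤ m i)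
        (U : Bond d (towerP L m (n + 1)) → 𝔸ˣ) (αU : ℕ → ℝ) (hα1 : ∀ j, αU j ≤ 1 / 64)
        (hU1 : ∀ (j : ℕ) (x : B7Prop1Explicit.Site d) (k : Fin d), perCfg (towerP L m (j + 1)) (UlevOf L m (n + 1) U j) x k ∈ U1 𝔸)
        (hreg : ∀ (j : ℕ) (y : TSite d (towerP L m j)) (k : Fin d) (ρ' : Fin d → Fin L),
          ‖((Wcx L (perCfg (towerP L m (j + 1)) (UlevOf L m (n + 1) U j)) (cornerSite L y) k (boxVec L ρ') : 𝔸ˣ) : 𝔸) - 1‖ ≤ αU j)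
        (εU : ℕ → ℝ) (_hεU : ∀ j, 0 ≤ εU j) (_hUε : ∀ (j : ℕ) (b : Bond d (towerP L m (j + 1))), ‖(UlevOf L m (n + 1) U j b : 𝔸) - 1‖ ≤ εU j)
        (_hLb : ∀ (j : ℕ) (b : Bond d (towerP L m (j + 1))), UlevOf L m (n + 1) U j b ∈ U1 𝔸)
        (α : ℝ) (_hα : 0 ≤ α) (_hαle : α ≤ α₁)
        (hUst : ∀ b, star (U b : 𝔸) = (((U b)⁻¹ : 𝔸ˣ) : 𝔸)) (_hUb : ∀ b, U b ∈ U1 𝔸) (_hUη : ∀ b, ‖(U b : 𝔸) - 1‖ ≤ α * η)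
        (_hpl : ∀ p : B9SectCLatticeCarrier.Plaq d (towerP L m (n + 1)), ‖(plaqHolU U p : 𝔸) - 1‖ ≤ α * η ^ 2)
        (_hεg : ∀ j < n + 1, εU j ≤ α * ϱ ^ j)
        (hpos' : ∀ x : SiteL2K ℂ d (towerP L m (n + 1)) c₀ W, x ≠ 0 → 0 < RCLike.re ⟪x, laplacePrimeAk L m n φ η U a' (c₁ := c₁) x⟫_ℂ)
        (rr : TSite d m → SiteL2K ℂ d m c₁ W →L[ℂ] SiteL2K ℂ d m c₁ W)
        (_hrr : ∀ (y : TSite d m) (g : SiteL2K ℂ d m c₁ W) (y' : TSite d m),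
          WL2.equiv ℂ (fun _ : TSite d m => c₁) W (rr y g) y' = if y' = y then WL2.equiv ℂ (fun _ : TSite d m => c₁) W g y' else 0)
        (v : TSite d m) (g : SiteL2K ℂ d m c₁ W) (F : ℝ) (_hgv : ∀ y, y ≠ v → WL2.equiv ℂ (fun _ : TSite d m => c₁) W g y = 0)
        (_hgF : ∀ y, ‖WL2.equiv ℂ (fun _ : TSite d m => c₁) W g y‖ ≤ F) (x : TSite d m),
        ‖WL2.equiv ℂ (fun _ : TSite d m => c₁) W
            (greenK _ (QGGQk_pos L m n φ c₀ η U c₁ a' (adTransportW_adjoint φ τ hτ₂ hUst hφτ) hpos') g) x‖ ≤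
          C * Real.exp (-(ρ * tdist m x v)) * F := by
  -- the floor `κ₁` (and its per-height letter) from the six-letter closing
  obtain ⟨α₀, γ, μ₁, γ', κ₁, M, hα₀, -, -, -, -, -, hκ₁, -, -, HL⟩ :=
    exists_H1_row_letters_diagonal_closed hd L hL hL3 φ hMφ hMφ' hφ hφ' ha ha' hϱ0 hϱ1 τ hτ hCτ hρw hτ₁ hτ₂ hφτ hMτ
  -- the point decay, `∃`-first given `κ₁`
  obtain ⟨α₁, C, ρ, hα₁, hC, hρ, HP⟩ := exists_point_decay_QGGQInvk L φ hMφ hMφ' hφ hφ' ha' hϱ0 hϱ1 hκ₁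
  refine ⟨min α₀ α₁, C, ρ, lt_min hα₀ hα₁, hC, hρ, ?_⟩
  intro n η hηL c₀ c₁ _ _ hw hρ' m _ hm U αU hα1 hU1 hreg εU hεU hUε hLb α hα hαle hUst hUb hUη hpl hεg hpos' rr hrr v g F hgv hgF x
  obtain ⟨-, -, -, -, hκ, -, -, -, -⟩ := HL n η hηL c₀ c₁ hw hρ' m U αU hα1 hU1 hreg εU hεU hUε hLb hα (hαle.trans (min_le_left _ _)) hUst hUb hUη hpl hεg
  have hRS : ∀ (b : Bond d (towerP L m (n + 1))) (v u : W), ⟪adTransportW φ U b v, u⟫_ℂ = ⟪v, adTransportW φ (fun b => (U b)⁻¹) b u⟫_ℂ :=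
    adTransportW_adjoint φ τ hτ₂ hUst hφτ
  have hX := hκ hpos'
  have hdec := HP n η hηL c₀ c₁ hw m hm U hRS α hα (hαle.trans (min_le_right _ _)) hUb hUη εU hεU hεg hUε hLb hpos'
    (fun g => by simpa only [LinearMap.comp_apply] using hX g) (greenK _ (QGGQk_pos L m n φ c₀ η U c₁ a' hRS hpos'))
    (fun w => by simpa only [LinearMap.comp_apply] using apply_greenK (QGGQk_pos L m n φ c₀ η U c₁ a' hRS hpos') w) rr hrr
  have h := local_of_point_decay_sites (c := c₁) hm (LinearMap.toContinuousLinearMap (greenK _ (QGGQk_pos L m n φ c₀ η U c₁ a' hRS hpos'))) hrr hrr hC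
    hdec v g F hgv hgF x
  simpa only [LinearMap.coe_toContinuousLinearMap'] using h

end Core

end Literature.MathematicalPhysics.QuantumFieldTheory.Balaban1983to89.B9Eq326WoodburyLettersTower

end
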